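import Summits.BirchSwinnertonDyer.BirchSwinnertonDyer.Theorems.QuadraticBranchSignedControlPlusEtaLowerInclusionValuationSqueezeTorsion
import Summits.BirchSwinnertonDyer.Rank1Residual.Additive.CyclotomicTowerSignedSelmerDual
import Literature.NumberTheory.EllipticCurves.IwasawaEulerCharDualityProofs
import HarnessLib

/-!
# Route `QuadraticBranchSignedControl` (rung K8, cell `bsd-potss`), crux `PlusEtaLowerInclusion`
# (item stmt-BirchSwinnertonDyer-19601): the index of ANY divisible subgroup of finite index in
# `Sel⁺(V/K_∞)^{η,Γ}` divides the leading coefficient of `Char X⁺(V/K_∞)^η` — the crux at a tower-onto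
# pair of any rank from the COTORSION of the `Γ`-invariant `η`-Selmer group

WHAT. Sixth file of the valuation-squeeze road (p499967, p500695, p502879, p503867, p505261). p505261
gave `#(X_η/TX_η)_tors ∣ #coker φ_{X_η} ~ coeff_r ξ_η` at a tower-onto pair. By the tree's duality
`X_η/TX_η ≃ Hom(S^Γ, ℚ/ℤ)` (`IwasawaDual.IsDualPair.exists_coinvariants_addEquiv`, `S = Sel⁺(V/K₀ℚ_∞)^η`,
`S^Γ = ker(conj_γ − 1)`) and the Pontryagin lemma of §1 — **for a DIVISIBLE subgroup `B ≤ A` of finite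
index, `tors Hom(A, ℚ/ℤ) = Hom(A/B, ℚ/ℤ)`, so `#tors Hom(A, ℚ/ℤ) = #(A/B)`** (characters of finite order
kill every divisible subgroup; `Hom(A/B, ℚ/ℤ)` is finite) — THIS FILE proves

  `#(S^Γ ⧸ B) ∣ #coker φ_{X_η}`  for every divisible `B ≤ S^Γ` of finite index,

and the ROAD: (E⁺_η)(V, p) ⟸ named facts + certificates + «some divisible `B ≤ S^Γ` of finite index has
`p^v ∣ #(S^Γ/B)`». WHY: the successor's TAMAGAWA ROAD takes `B` = the image of `W(ℚ) ⊗ ℚ_p/ℤ_p` under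
Kummer ∘ restriction (divisible; finite index by the bottom-layer control + GZK), for which
`#(S^Γ/B) ≥ #coker(Sel_{p^∞}(W/ℚ) → S^Γ) = #(K_Tam ∩ im λ_ℚ) ≥ #K_Tam / exp K_Tam` (control with
`W(K_∞)[p] = 0`; Poitou–Tate with `𝔖(W) ≅ ℤ_p` in rank one) — NOT proved here. With two Tamagawa-`p`
primes (`K_Tam ≅ (ℤ/p)²`, 14 of the 17 λ-defect rank-one census rows) that gives `v_alg ≥ 1`, closing the
rows with `v_an = 1`.

HONEST FRAMING (cell `bsd-potss`, run/shared/lean/pub/bsd-potss/; FULL-BSD rank ≤ 1 programme, HUMAN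
RULING D-0036/D-0074): TOOL THEOREMS ONLY, CONDITIONAL on the named Literature facts (Kobayashi 2003
Thm. 1.2/1.3/2.2η/4.1η, Kitajima–Otsuki 2018 Thm. 1.3 at `η`; hypothesis position), on the tower-onto
hypothesis, the `V`-certificate and the analytic certificate (NOT supplied here for any pair), and in §3
on the displayed cotorsion input (OPEN on the rank-one rows). The crux 19601 is OPEN class-wide and NOT
closed; nothing is booked; `BSD(W, p)` is claimed for no pair. No definition, no named fact, no
`sorry`, axioms standard. Seat `bsd-potss-k8eta-c1` (prover), g3; `--supports stmt-BirchSwinnertonDyer-19601`.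

References: [Kobayashi2003] Thm. 2.2, §4 + Thm. 4.1; [KitajimaOtsuki2018] Thm. 1.3;
[CoatesSchneiderSujatha2003] §3 (30)–(31); [GreenbergLNM1716] §1 p. 60, §3–4 (control).
-/

set_option autoImplicit false
set_option linter.dupNamespace false
noncomputable section

open scoped Classical
open CongruenceSubgroup Field WeierstrassCurve
open Literature.NumberTheory.EllipticCurves
open Literature.NumberTheory.EllipticCurves.ModularForms
open Literature.NumberTheory.GaloisRepresentations
open Summit.BirchSwinnertonDyer.Rank1Residual.Additive

namespace Summit.BirchSwinnertonDyer.BirchSwinnertonDyer.Theorems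

/-! ## §1 Pontryagin: torsion characters and divisible subgroups of finite index -/

section Pontryagin

variable {A : Type} [AddCommGroup A]

/-- `(n • χ) a = n • χ a` for characters (the `ℕ`-action on `Hom(A, ℚ/ℤ)` is pointwise). [folklore] -/
theorem characterModule_nsmul_apply (n : ℕ) (c : CharacterModule A) (a : A) : (n • c) a = n • c a := by
  induction n with
  | zero => rw [zero_nsmul, zero_nsmul]; rfl
  | succ n ih => rw [succ_nsmul, succ_nsmul, IwasawaDual.characterModule_add_apply, ih]

/-- **`#tors Hom(A, ℚ/ℤ) = #(A/B)` for a divisible subgroup `B ≤ A` of finite index**: a character of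
finite order `n` kills `nB = B`, so it factors through the finite group `A/B`; conversely every
character of `A/B` has finite order. Hence `χ' ↦ χ' ∘ mk` is a bijection
`Hom(A/B, ℚ/ℤ) ≃ tors Hom(A, ℚ/ℤ)`, and `#Hom(A/B, ℚ/ℤ) = #(A/B)`. [folklore] -/
theorem natCard_torsion_characterModule_eq_of_divisible (B : AddSubgroup A)
    (hdiv : ∀ n : ℕ, n ≠ 0 → ∀ b ∈ B, ∃ b' ∈ B, n • b' = b) (hfin : Finite (A ⧸ B)) :
    Nat.card (AddCommGroup.torsion (CharacterModule A)) = Nat.card (A ⧸ B) := by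
  haveI := hfin
  haveI : Finite (CharacterModule (A ⧸ B)) := PontryaginCard.finite_characterModule_of_finite _
  -- the map `χ' ↦ χ' ∘ mk`, valued in the torsion subgroup
  let ρ : CharacterModule (A ⧸ B) →+ CharacterModule A :=
    AddMonoidHom.compHom' (QuotientAddGroup.mk' B)
  have hρ : ∀ (χ' : CharacterModule (A ⧸ B)) (a : A), ρ χ' a = χ' (QuotientAddGroup.mk' B a) :=
    fun _ _ => rfl
  have hρtors : ∀ χ', ρ χ' ∈ AddCommGroup.torsion (CharacterModule A) := fun χ' =>
    (AddCommGroup.mem_torsion _).mpr (ρ.isOfFinAddOrder (isOfFinAddOrder_of_finite χ'))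
  let f : CharacterModule (A ⧸ B) → AddCommGroup.torsion (CharacterModule A) :=
    fun χ' => ⟨ρ χ', hρtors χ'⟩
  have hf : Function.Bijective f := by
    constructor
    · intro χ₁ χ₂ h
      have h' : ρ χ₁ = ρ χ₂ := congrArg Subtype.val h
      refine CharacterModule.ext (A := A ⧸ B) fun q => ?_
      obtain ⟨a, rfl⟩ := QuotientAddGroup.mk'_surjective B q
      have h'' := DFunLike.congr_fun h' a
      rw [hρ, hρ] at h''
      exact h''
    · rintro ⟨χ, hχ⟩
      obtain ⟨n, hn, hnχ⟩ := ((AddCommGroup.mem_torsion _).mp hχ).exists_nsmul_eq_zero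
      -- `χ` kills the divisible subgroup `B`
      have hχB : ∀ b ∈ B, χ b = 0 := by
        intro b hb
        obtain ⟨b', -, rfl⟩ := hdiv n hn.ne' b hb
        have h0 := DFunLike.congr_fun hnχ b'
        rw [characterModule_nsmul_apply, IwasawaDual.characterModule_zero_apply] at h0
        rw [map_nsmul, h0]
      refine ⟨QuotientAddGroup.lift B χ fun b hb => (AddMonoidHom.mem_ker).mpr (hχB b hb), ?_⟩
      apply Subtype.ext
      exact CharacterModule.ext (A := A) fun a => rfl
  rw [← Nat.card_congr (Equiv.ofBijective f hf), PontryaginCard.natCard_characterModule]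

/-- The torsion subgroups of additively isomorphic groups have the same order. [folklore] -/
theorem natCard_torsion_congr {M N : Type*} [AddCommGroup M] [AddCommGroup N] (e : M ≃+ N) :
    Nat.card (AddCommGroup.torsion M) = Nat.card (AddCommGroup.torsion N) := by
  refine Nat.card_congr
    { toFun := fun x => ⟨e x, (AddCommGroup.mem_torsion _).mpr
        (e.toAddMonoidHom.isOfFinAddOrder ((AddCommGroup.mem_torsion _).mp x.2))⟩
      invFun := fun y => ⟨e.symm y, (AddCommGroup.mem_torsion _).mpr
        (e.symm.toAddMonoidHom.isOfFinAddOrder ((AddCommGroup.mem_torsion _).mp y.2))⟩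
      left_inv := fun x => Subtype.ext (e.symm_apply_apply x)
      right_inv := fun y => Subtype.ext (e.apply_symm_apply y) }

end Pontryagin

/-! ## §2–3 The `η`-datum at a tower-onto pair -/

section Pair

variable {V : WeierstrassCurve ℚ} [V.IsElliptic] [V.IsGloballyMinimal] {p : ℕ} [Fact p.Prime]

/-- **The index of every divisible finite-index subgroup of `Sel⁺(V/K₀ℚ_∞)^{η,Γ}` divides
`#coker φ_{X_η}`** at a tower-onto pair: GRANTED Kobayashi's Thm. 1.2 / 1.3 / 2.2(η) / 4.1(η) and
Kitajima–Otsuki's Thm. 1.3 at `η` (NAMED facts), on a good `a_p = 0` pair with `p ≥ 5`, `ρ_{V,p^m}` onto,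
the `V`-certificate and `coeff_r L_p⁺(V,η,T) ≠ 0`: for every `η`-datum `D` and every divisible subgroup
`B` of `S^Γ = ker(conj_γ − 1) ≤ S = Sel⁺(V/K₀ℚ_∞)^η` with `S^Γ/B` finite,
`#(S^Γ/B) ∣ #coker(φ : D.X[T] → D.X/T·D.X)` (`= #(D.X/T·D.X)_tors` by §1 and the duality
`D.X/T·D.X ≃ Hom(S^Γ, ℚ/ℤ)`; then p505261). Hence it divides `coeff_r` of `Char(D.X)` up to a unit
(p502879). CONDITIONAL; asserts nothing on any specific `B`.
[cite: Kobayashi2003, Thm. 2.2 (p. 5), Thm. 4.1 and §4 (p. 8)] [cite: KitajimaOtsuki2018, Thm. 1.3]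
[cite: GreenbergLNM1716, §1 p. 60] -/
theorem natCard_quotient_divisible_dvd_natCard_coker_bockstein
    (h12 : Kobayashi2003.thm12_signedSelmerDual_finite_torsion)
    (h13 : Kobayashi2003.thm41_signedCharIdeal_divisibility)
    (h22 : Kobayashi2003.thm22_etaSignedSelmerDual_finite_torsion)
    (h41 : Kobayashi2003.thm41_plusEtaCharIdeal_dvd)
    (hKO : KitajimaOtsuki2018.mainThm13_etaSignedSelmerDual_noFiniteSubmodule)
    (hp5 : 5 ≤ p) (hgood : V.HasGoodReductionAtPrime p) (hap : V.frobeniusTrace p = 0)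
    (hsurj : ∀ m : ℕ, V.HasSurjectiveModNGaloisRep (p ^ m : ℕ))
    (hcertV : ∀ {N : ℕ} [NeZero N] (f : CuspForm (Gamma0 N) 2), IsNewformOf V f →
      ∃ L : IwasawaAlgebra p, Kobayashi2003.IsSignedPAdicLFunction f p 1 L ∧
        IsUnit (PowerSeries.coeff V.mordellWeilRank L))
    {N : ℕ} [NeZero N] {f : CuspForm (Gamma0 N) 2} (hf : IsNewformOf V f) (ϖ : ℚ)
    (hϖ : if Even (p / 2) then (ϖ : ℝ) * V.realPeriodRat = plusPeriod f
      else (ϖ : ℝ) * V.imaginaryPeriodRat = minusPeriod f)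
    (Lη : IwasawaAlgebra p) (hL : IsQuadraticBranchPlusLFunction f p ϖ Lη)
    (hne : PowerSeries.coeff (V.quadraticTwist ((-1) ^ (p / 2) * p)).mordellWeilRank Lη ≠ 0)
    (K₀ : Type) [Field K₀] [NumberField K₀] [IsCyclotomicExtension {p} ℚ K₀]
    [(galRange (K := ℚ) K₀).Normal] (ηq : absoluteGaloisGroup ℚ →* ℤˣ)
    (hηK : ∀ σ ∈ galRange (K := ℚ) K₀, ηq σ = 1) (hη1 : ηq ≠ 1)
    (κ : ZpExtension ℚ p) (γ : absoluteGaloisGroup ℚ) (hκ : κ.IsCyclotomic) (hγ : κ.IsTopGenerator γ)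
    (hγK : γ ∈ galRange (K := ℚ) K₀) (hγc : IsCyclotomicVariable p γ)
    (D : EtaSignedSelmerDualData V κ K₀ ℚ_[p] ηq γ 1)
    (B : AddSubgroup (IwasawaDual.endInvariants (conjTowerSignedSelmerInftyEta V κ K₀ ℚ_[p] ηq 1 γ - 1)))
    (hdiv : ∀ n : ℕ, n ≠ 0 → ∀ b ∈ B, ∃ b' ∈ B, n • b' = b)
    (hfin : Finite (IwasawaDual.endInvariants (conjTowerSignedSelmerInftyEta V κ K₀ ℚ_[p] ηq 1 γ - 1) ⧸ B)) :
    Nat.card (IwasawaDual.endInvariants (conjTowerSignedSelmerInftyEta V κ K₀ ℚ_[p] ηq 1 γ - 1) ⧸ B) ∣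
      Nat.card (IwasawaAlgebra.coinvariants p D.X ⧸
        LinearMap.range (IwasawaAlgebra.bockstein p D.X)) := by
  obtain ⟨-, hdvd⟩ := ker_bockstein_eq_bot_and_natCard_torsion_coinvariants_dvd h12 h13 h22 h41 hKO
    hp5 hgood hap hsurj (fun f hf => hcertV f hf) hf ϖ hϖ Lη hL hne K₀ ηq hηK hη1 κ γ hκ hγ hγK hγc D
  have hdual := EtaSignedSelmerDualData.isDualPair V κ K₀ ℚ_[p] ηq 1 D
    (kappa_surjOn_galRange_cyclotomic κ K₀) hγ hγK
  obtain ⟨Ψ, -⟩ := hdual.exists_coinvariants_addEquiv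
  rw [natCard_torsion_congr Ψ, natCard_torsion_characterModule_eq_of_divisible B hdiv hfin] at hdvd
  exact hdvd

/-- **(E⁺_η) AT A TOWER-ONTO PAIR OF ANY RANK from the COTORSION of `Sel⁺(V/K_∞)^{η,Γ}`.** GRANTED
Kobayashi's Thm. 1.2 / 1.3 / 2.2(η) / 4.1(η) and Kitajima–Otsuki's Thm. 1.3 at `η` (NAMED facts),
`p ≥ 5`, `V` good with `a_p = 0`, `ρ_{V,p^m}` onto, the `V`-certificate, ONE integer `v` with the
ANALYTIC certificate `p^{v+1} ∤ coeff_r L_p⁺(V,η,T)` (`r = rank V^{(p*)}(ℚ)`) and the input: for every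
admissible `(K₀, η, κ, γ)` SOME divisible subgroup `B` of `S^Γ` (`S = Sel⁺(V/K₀ℚ_∞)^η`) of finite
index has `p^v ∣ #(S^Γ/B)`. Then (E⁺_η)(V, p). The intended `B` (successor): the Kummer image of
`W(ℚ) ⊗ ℚ_p/ℤ_p`, whose index carries the Tamagawa defect of the bottom-layer control. CONDITIONAL;
closes nothing. [cite: Kobayashi2003, Thm. 2.2 (p. 5), Thm. 4.1 and §4 (p. 8)] [cite: KitajimaOtsuki2018, Thm. 1.3]
[cite: GreenbergLNM1716, §1 p. 60 and §3–4] -/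
theorem quadraticBranchPlusEtaLowerInclusionAt_of_namedFacts_of_certV_of_divisibleIndexDvd
    (h12 : Kobayashi2003.thm12_signedSelmerDual_finite_torsion)
    (h13 : Kobayashi2003.thm41_signedCharIdeal_divisibility)
    (h22 : Kobayashi2003.thm22_etaSignedSelmerDual_finite_torsion)
    (h41 : Kobayashi2003.thm41_plusEtaCharIdeal_dvd)
    (hKO : KitajimaOtsuki2018.mainThm13_etaSignedSelmerDual_noFiniteSubmodule)
    (hp5 : 5 ≤ p) (hgood : V.HasGoodReductionAtPrime p) (hap : V.frobeniusTrace p = 0)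
    (hsurj : ∀ m : ℕ, V.HasSurjectiveModNGaloisRep (p ^ m : ℕ))
    (hcertV : ∀ {N : ℕ} [NeZero N] (f : CuspForm (Gamma0 N) 2), IsNewformOf V f →
      ∃ L : IwasawaAlgebra p, Kobayashi2003.IsSignedPAdicLFunction f p 1 L ∧
        IsUnit (PowerSeries.coeff V.mordellWeilRank L))
    (v : ℕ)
    (han : ∀ {N : ℕ} [NeZero N] {f : CuspForm (Gamma0 N) 2}, IsNewformOf V f →
      ∀ (ϖ : ℚ), (if Even (p / 2) then (ϖ : ℝ) * V.realPeriodRat = plusPeriod f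
          else (ϖ : ℝ) * V.imaginaryPeriodRat = minusPeriod f) →
      ∀ (Lη : IwasawaAlgebra p), IsQuadraticBranchPlusLFunction f p ϖ Lη →
        ¬ (p : ℤ_[p]) ^ (v + 1) ∣
          PowerSeries.coeff (V.quadraticTwist ((-1) ^ (p / 2) * p)).mordellWeilRank Lη)
    (hcot : ∀ (K₀ : Type) [Field K₀] [NumberField K₀] [IsCyclotomicExtension {p} ℚ K₀]
      [(galRange (K := ℚ) K₀).Normal] (ηq : absoluteGaloisGroup ℚ →* ℤˣ),
      (∀ σ ∈ galRange (K := ℚ) K₀, ηq σ = 1) → ηq ≠ 1 →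
      ∀ (κ : ZpExtension ℚ p) (γ : absoluteGaloisGroup ℚ),
        κ.IsCyclotomic → κ.IsTopGenerator γ → γ ∈ galRange (K := ℚ) K₀ → IsCyclotomicVariable p γ →
      ∃ B : AddSubgroup
          (IwasawaDual.endInvariants (conjTowerSignedSelmerInftyEta V κ K₀ ℚ_[p] ηq 1 γ - 1)),
        (∀ n : ℕ, n ≠ 0 → ∀ b ∈ B, ∃ b' ∈ B, n • b' = b) ∧
        Finite (IwasawaDual.endInvariants (conjTowerSignedSelmerInftyEta V κ K₀ ℚ_[p] ηq 1 γ - 1) ⧸ B) ∧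
        p ^ v ∣ Nat.card
          (IwasawaDual.endInvariants (conjTowerSignedSelmerInftyEta V κ K₀ ℚ_[p] ηq 1 γ - 1) ⧸ B)) :
    QuadraticBranchPlusEtaLowerInclusionAt V p := by
  intro K₀ _ _ _ _ ηq hηK hη1 N _ f hp2 hgood' hap' hf ϖ hϖ Lη hL κ γ hκ hγ hγK hγc D
  obtain ⟨hfinD, htor⟩ :=
    EtaSignedSelmerDualData.finite_isTorsion_of_thm22 h22 hηK hp2 hgood' hap' hκ hγ hγK D
  haveI : Module.Finite (IwasawaAlgebra p) D.X := hfinD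
  obtain ⟨g, hg⟩ := (charIdeal_isPrincipal_holds p D.X).principal
  have hg' : D.charIdeal = Ideal.span {g} := hg
  -- Kato side: `g ∣ Lη`
  obtain ⟨-, hup⟩ := EtaSignedSelmerDualData.thm41_plus_of_facts h22 h41 hηK hη1 hp2 hgood' hap' hf
    ϖ hϖ Lη hL hκ hγ hγK hγc D
  have hgL : g ∣ Lη := by
    have h := hup hsurj
    rw [hg', Ideal.span_singleton_le_span_singleton] at h
    exact h
  have hanL := han hf ϖ hϖ Lη hL
  have hne : PowerSeries.coeff (V.quadraticTwist ((-1) ^ (p / 2) * p)).mordellWeilRank Lη ≠ 0 :=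
    fun h0 => hanL (by rw [h0]; exact dvd_zero _)
  -- rank bound, leading coefficient, cotorsion divisibility
  have hXg := X_pow_twistRank_dvd_etaCharGenerator_of_namedFacts_of_certV h12 h13 h22 hp5 hgood hap
    hsurj (fun f hf => hcertV f hf) hf K₀ ηq hηK hη1 κ γ hκ hγ hγK hγc D hg'
  obtain ⟨u, hu⟩ := coeff_twistRank_etaCharGenerator_eq_unit_mul_card_coker_bockstein h12 h13 h22 h41
    hKO hp5 hgood hap hsurj (fun f hf => hcertV f hf) hf ϖ hϖ Lη hL hne K₀ ηq hηK hη1 κ γ hκ hγ hγK hγc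
    D hg'
  obtain ⟨B, hdiv, hfin, hpB⟩ := hcot K₀ ηq hηK hη1 κ γ hκ hγ hγK hγc
  have hdvd := natCard_quotient_divisible_dvd_natCard_coker_bockstein h12 h13 h22 h41 hKO hp5 hgood hap
    hsurj (fun f hf => hcertV f hf) hf ϖ hϖ Lη hL hne K₀ ηq hηK hη1 κ γ hκ hγ hγK hγc D B hdiv hfin
  have halg : (p : ℤ_[p]) ^ v ∣
      PowerSeries.coeff (V.quadraticTwist ((-1) ^ (p / 2) * p)).mordellWeilRank g := by
    rw [hu]
    obtain ⟨c, hc⟩ := hpB.trans hdvd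
    refine Dvd.dvd.mul_left ?_ _
    rw [hc, Nat.cast_mul, Nat.cast_pow]
    exact dvd_mul_right _ _
  have heq : Ideal.span {g} = Ideal.span {Lη} :=
    span_singleton_eq_of_X_pow_dvd_of_dvd_of_pow_dvd_coeff hXg hgL halg hanL
  rw [← heq, ← hg']

end Pair

end Summit.BirchSwinnertonDyer.BirchSwinnertonDyer.Theorems

end
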